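import Summits.KontsevichZagierPeriods.KontsevichZagierPeriods.Theorems.HurwitzMicroSectorsNormalFormPrincipleM4SharedTools
import Summits.KontsevichZagierPeriods.KontsevichZagierPeriods.Theorems.HurwitzMicroSectorsNormalFormPrincipleM4BoxSubSimplex4
import Summits.KontsevichZagierPeriods.KontsevichZagierPeriods.Theorems.HyperbolicBlochOffTetraSectorKernelStubAffineOrbit
import Literature.NumberTheory.Transcendental.KZProductIdeal

/-!
# `NormalFormPrinciple` (stmt-KontsevichZagierPeriods-3869), line `SketchIdeator1` —
# leaf `stub_boxRigidity`, layer `M4` packages: the box-stuffle `P(ab,ac) = [aaac] + [abac] − [acac]`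

Pure proof file (registered sub-goal `m4_rel_bstuffle22pm` of stmt-KontsevichZagierPeriods-3869,
line `SketchIdeator1`, lead seat c9; layer `M4` packages of the dimension-four campaign of the
leaf `stub_boxRigidity`; `--supports` the crux). Letters on `(0,1)`: `a(u) = 1/u`,
`b(u) = 1/(1−u)`, `c(u) = 1/(1+u)`; `[ab]`, `[ac]` are the weight-two words on the decreasing
simplex `Δ₂ = {1 > t₀ > t₁ > 0}` (values `ζ(2)`, `−Li₂(−1)`), `[aaac]`, `[abac]`, `[acac]` weight-four
words on `Δ₄ = {1 > t₀ > t₁ > t₂ > t₃ > 0}`, and `P(ab,ac) = [AB.prod AC]` is the product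
representation (`KZ.IntegralRep.prod`). The row proved here is the STUFFLE (quasi-shuffle)
`[ab] ⋆ [ac] = [aaac] + [abac] − [acac]` (`ζ(2)·Li` products: `Σ_{m} Σ_{n} = Σ_{m>n} + Σ_{m<n} + Σ_{m=n}`)
as a chain of Kontsevich–Zagier moves:

* the dimension-two cubical charts (rule 2) identify `[ab]`, `[ac]` with the boxes
  `[□², 1/(1 − x₀x₁)]`, `[□², 1/(1 + x₀x₁)]`, hence (product ideal, `KZ.Equivalent.prod`)
  `P(ab,ac)` with the product box `N = [□⁴, 1/((1 − x₀x₁)(1 + x₂x₃))]`;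
* stuffle = ONE integrand-additivity move (rule 1b) on the product box, the three-term partial
  fraction `1/((1−u)(1+v)) = 1/(1+uv) + u/((1−u)(1+uv)) − v/((1+v)(1+uv))` (`u = x₀x₁`,
  `v = x₂x₃`, `uv = x₀x₁x₂x₃`);
* ONE coordinate permutation (rule 2, `KZ.of_sub_of_reindex_mem_relations`) turning the third box
  `[□⁴, x₂x₃/((1 + x₂x₃)(1 + x₀x₁x₂x₃))]` into the standard nested order;
* three cubical charts `(x₀, x₀x₁, x₀x₁x₂, x₀x₁x₂x₃)` (rule 2, `m4_box_sub_simplex4`) of the boxes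
  `[□⁴, 1/(1+Π)]`, `[□⁴, u/((1−u)(1+Π))]`, `[□⁴, u/((1+u)(1+Π))]` onto `[aaac]`, `[abac]`, `[acac]`.

Sources: M. Kontsevich, D. Zagier, *Periods* (2001), §1.2 rules (1b), (2), §4.1; M. E. Hoffman,
*The algebra of multiple harmonic series*, J. Algebra 194 (1997) (quasi-shuffle).
No definitions are introduced.
-/

noncomputable section

open MeasureTheory Set
open Literature.NumberTheory.Transcendental Literature.NumberTheory.Transcendental.KZ
open Literature.ModelTheory.ExponentialFields (IsSemialgebraic continuous_aeval_real)
open Summit.KontsevichZagierPeriods.HyperbolicBloch.OffTetraSectorKernel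
  (aff_orbit_of_sub_sum_zsmul_mem_relations)
open Summit.KontsevichZagierPeriods.HurwitzMicroSectors.NormalFormPrinciple.PiBox.Dilog
  (exists_dilogBox bss_box_sub_simplex_of_one_le integrableOn_dilogIntegrand mul_mem_Ioo_of_mem_box)

namespace Summit.KontsevichZagierPeriods.HurwitzMicroSectors.NormalFormPrinciple.PiBox.M3

/-! ## Tools: sign facts on the box, box representations by domination -/

/-- Sign facts for the coordinates of a point of `□⁴` and their products. [folklore] -/
private theorem m4k_box_facts {x : Fin 4 → ℝ} (hx : ∀ i, x i ∈ Set.Ioo (0:ℝ) 1) :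
    0 < x 0 ∧ 0 < x 1 ∧ 0 < x 2 ∧ 0 < x 3 ∧ 0 < x 0 * x 1 ∧ x 0 * x 1 < 1 ∧
      0 < x 2 * x 3 ∧ x 2 * x 3 < 1 ∧ 0 < x 0 * x 1 * x 2 * x 3 :=
  ⟨(hx 0).1, (hx 1).1, (hx 2).1, (hx 3).1, mul_pos (hx 0).1 (hx 1).1,
    mul_lt_one_of_nonneg_of_lt_one_left (hx 0).1.le (hx 0).2 (hx 1).2.le,
    mul_pos (hx 2).1 (hx 3).1,
    mul_lt_one_of_nonneg_of_lt_one_left (hx 2).1.le (hx 2).2 (hx 3).2.le,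
    mul_pos (mul_pos (mul_pos (hx 0).1 (hx 1).1) (hx 2).1) (hx 3).1⟩

/-- **A box representation `[□ⁿ, p/q]` exists** for `ℚ`-polynomials `p`, `q` with `q ≠ 0` on the
open unit box, as soon as `|p/q|` is dominated there by an integrable function: the integrand is
`ℚ`-semialgebraic (a quotient of polynomials) and continuous on the box.
[cite: KontsevichZagier2001, §1.1] -/
private theorem m4k_exists_box {n : ℕ} {F G : (Fin n → ℝ) → ℝ} (p q : MvPolynomial (Fin n) ℚ)
    (hF : ∀ x, F x = (MvPolynomial.aeval x p : ℝ) / MvPolynomial.aeval x q)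
    (hq : ∀ x ∈ {x : Fin n → ℝ | ∀ i, x i ∈ Set.Ioo (0:ℝ) 1}, (MvPolynomial.aeval x q : ℝ) ≠ 0)
    (hG : IntegrableOn G {x : Fin n → ℝ | ∀ i, x i ∈ Set.Ioo (0:ℝ) 1})
    (hle : ∀ x ∈ {x : Fin n → ℝ | ∀ i, x i ∈ Set.Ioo (0:ℝ) 1}, |F x| ≤ G x) :
    ∃ T : IntegralRep n, T.domain = {x | ∀ i, x i ∈ Set.Ioo (0:ℝ) 1} ∧ T.integrand = F := by
  have hB := isSemialgebraic_box n
  have hm : MeasurableSet {x : Fin n → ℝ | ∀ i, x i ∈ Set.Ioo (0:ℝ) 1} := hB.measurableSet_holds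
  have hc : ContinuousOn F {x : Fin n → ℝ | ∀ i, x i ∈ Set.Ioo (0:ℝ) 1} :=
    ((continuous_aeval_real p).continuousOn.div (continuous_aeval_real q).continuousOn hq).congr
      fun x _ => hF x
  refine ⟨⟨_, F, hB, (isSemialgebraicFunOn_aeval_div_aeval hB p q hq).congr
    fun x _ => (hF x).symm, ?_⟩, rfl, rfl⟩
  refine Integrable.mono' hG (hc.aestronglyMeasurable hm) ?_
  exact (ae_restrict_iff' hm).2 (Filter.Eventually.of_forall
    fun x hx => (Real.norm_eq_abs _).le.trans (hle x hx))

/-! ## The registered sub-goal -/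

/-- **Stub `m4_rel_bstuffle22pm` (registered sub-goal of stmt-KontsevichZagierPeriods-3869, line
`SketchIdeator1`, layer `M4` packages).** The box-stuffle `P(ab,ac) = [aaac] + [abac] − [acac]`:
for arbitrary carriers `[ab]`, `[ac]` on `Δ₂` and `[aaac]`, `[abac]`, `[acac]` on `Δ₄` with the
displayed integrands, `[AB.prod AC] − [AAAC] − [ABAC] + [ACAC] ∈ KZ.relations`. Chain of moves:
dimension-two cubical charts and the product ideal (`P(ab,ac) ≡` the product box
`[□⁴, 1/((1−x₀x₁)(1+x₂x₃))]`), ONE integrand-additivity move on the product box (the three-term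
partial fraction `1/((1−u)(1+v)) = 1/(1+uv) + u/((1−u)(1+uv)) − v/((1+v)(1+uv))`), one coordinate
permutation, and three cubical charts onto the words.
[cite: KontsevichZagier2001, §1.2 rules (1), (2), §4.1] -/
theorem m4_rel_bstuffle22pm :
    ∀ (AB : IntegralRep 2), AB.domain = {t | 0 < t 1 ∧ t 1 < t 0 ∧ t 0 < 1} → (AB.integrand = fun t => 1 / t 0 * (1 / (1 - t 1))) →
      ∀ (AC : IntegralRep 2), AC.domain = {t | 0 < t 1 ∧ t 1 < t 0 ∧ t 0 < 1} → (AC.integrand = fun t => 1 / t 0 * (1 / (1 + t 1))) →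
      ∀ (AAAC : IntegralRep 4), AAAC.domain = {t | 0 < t 3 ∧ t 3 < t 2 ∧ t 2 < t 1 ∧ t 1 < t 0 ∧ t 0 < 1} → (AAAC.integrand = fun t => 1 / t 0 * (1 / t 1) * (1 / t 2) * (1 / (1 + t 3))) →
      ∀ (ABAC : IntegralRep 4), ABAC.domain = {t | 0 < t 3 ∧ t 3 < t 2 ∧ t 2 < t 1 ∧ t 1 < t 0 ∧ t 0 < 1} → (ABAC.integrand = fun t => 1 / t 0 * (1 / (1 - t 1)) * (1 / t 2) * (1 / (1 + t 3))) →
      ∀ (ACAC : IntegralRep 4), ACAC.domain = {t | 0 < t 3 ∧ t 3 < t 2 ∧ t 2 < t 1 ∧ t 1 < t 0 ∧ t 0 < 1} → (ACAC.integrand = fun t => 1 / t 0 * (1 / (1 + t 1)) * (1 / t 2) * (1 / (1 + t 3))) →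
      of (AB.prod AC) - of AAAC - of ABAC + of ACAC ∈ relations := by
  intro AB hABd hABi AC hACd hACi AAAC hAAACd hAAACi ABAC hABACd hABACi ACAC hACACd hACACi
  /- (i) the dimension-two boxes `B2m = [□², 1/(1 − x₀x₁)] ≡ [ab]`, `B2p = [□², 1/(1 + x₀x₁)] ≡ [ac]`
    (cubical charts, rule 2) and their product `N ≡ P(ab,ac)` (product ideal) -/
  obtain ⟨B2m, hB2md, hB2mi⟩ := exists_dilogBox (a := (1:ℝ)) isAlgebraic_one (Or.inl le_rfl)
  obtain ⟨B2p, hB2pd, hB2pi⟩ : ∃ B : IntegralRep 2, B.domain = {x | ∀ i, x i ∈ Set.Ioo (0:ℝ) 1} ∧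
      B.integrand = fun x => 1 / (1 + x 0 * x 1) := by
    refine m4k_exists_box 1 (1 + MvPolynomial.X 0 * MvPolynomial.X 1)
      (fun x => by simp only [map_one, map_add, map_mul, MvPolynomial.aeval_X]) (fun x hx => ?_)
      (integrableOn_dilogIntegrand (a := (1:ℝ)) (Or.inl le_rfl)) fun x hx => ?_
    · have h := mul_mem_Ioo_of_mem_box hx
      simp only [map_add, map_one, map_mul, MvPolynomial.aeval_X]
      exact (show (0:ℝ) < 1 + x 0 * x 1 by linarith [h.1]).ne'
    · have h := mul_mem_Ioo_of_mem_box hx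
      show |1 / (1 + x 0 * x 1)| ≤ 1 / (1 - x 0 * x 1)
      rw [abs_of_pos (one_div_pos.2 (by linarith [h.1]))]
      exact one_div_le_one_div_of_le (by linarith [h.2]) (by linarith [h.1])
  have hm : of B2m - of AB ∈ relations :=
    bss_box_sub_simplex_of_one_le (a := 1) (z := 1) isAlgebraic_one le_rfl (one_mul 1) B2m AB
      hB2md (hB2mi ▸ fun _ _ => rfl) hABd fun t _ => by simp only [hABi, one_div_mul_one_div]
  have hp : of B2p - of AC ∈ relations := by
    refine m4_box_sub_simplex2 (fun t => 1 / t 0 * (1 / (1 + t 1))) B2p AC hB2pd hACd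
      (hACi ▸ fun _ _ => rfl) fun x hx => ?_
    have hx' : ∀ i, x i ∈ Set.Ioo (0:ℝ) 1 := by rw [hB2pd] at hx; exact hx
    have h0 : x 0 ≠ 0 := (hx' 0).1.ne'
    have h01 : 1 + x 0 * x 1 ≠ 0 := (add_pos one_pos (mul_pos (hx' 0).1 (hx' 1).1)).ne'
    simp only [hB2pi, Matrix.cons_val_zero, Matrix.cons_val_one]
    field_simp
  obtain ⟨N, hN⟩ : ∃ N : IntegralRep 4, N = B2m.prod B2p := ⟨_, rfl⟩
  have hNd : N.domain = {x | ∀ i, x i ∈ Set.Ioo (0:ℝ) 1} := by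
    rw [hN]
    ext z
    rw [IntegralRep.prod_domain B2m B2p, IntegralRep.mem_prodDomain B2m B2p, hB2md, hB2pd]
    simp only [mem_setOf_eq]
    constructor
    · rintro ⟨h1, h2⟩ i
      exact Fin.addCases (m := 2) (n := 2) (motive := fun i => z i ∈ Set.Ioo (0:ℝ) 1)
        (fun i => h1 i) (fun j => h2 j) i
    · intro h
      exact ⟨fun i => h _, fun j => h _⟩
  have hNi : ∀ z, N.integrand z = 1 / (1 - z 0 * z 1) * (1 / (1 + z 2 * z 3)) := fun z => by
    rw [hN, IntegralRep.prod_integrand_eq B2m B2p, IntegralRep.prodFun_apply B2m B2p, hB2mi, hB2pi]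
    rfl
  have hP : of N - of (AB.prod AC) ∈ relations := by
    rw [hN]
    exact Equivalent.prod hm hp
  /- (ii) the stuffle: ONE integrand-additivity move on the product box,
    `N = T3 + U1 − U2p` with `T3 = [□⁴, 1/(1+Π)]`, `U1 = [□⁴, u/((1−u)(1+Π))]`,
    `U2p = [□⁴, v/((1+v)(1+Π))]` (`u = x₀x₁`, `v = x₂x₃`, `Π = x₀x₁x₂x₃`) -/
  obtain ⟨T3, hT3d, hT3i⟩ := m4t_exists_plusBox4
  have hG3 : IntegrableOn (fun x : Fin 4 → ℝ => 1 / (1 + x 0 * x 1 * x 2 * x 3))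
      {x : Fin 4 → ℝ | ∀ i, x i ∈ Set.Ioo (0:ℝ) 1} := by
    have h := T3.integrableOn
    rwa [hT3d, hT3i] at h
  have hGN : IntegrableOn (fun x : Fin 4 → ℝ => 2 * (1 / (1 - x 0 * x 1) * (1 / (1 + x 2 * x 3))))
      {x : Fin 4 → ℝ | ∀ i, x i ∈ Set.Ioo (0:ℝ) 1} := by
    have h := N.integrableOn
    rw [hNd] at h
    exact IntegrableOn.congr_fun (h.const_mul 2) (fun x _ => by simp only [hNi])
      (isSemialgebraic_box 4).measurableSet_holds
  obtain ⟨U1, hU1d, hU1i⟩ : ∃ U : IntegralRep 4, U.domain = {x | ∀ i, x i ∈ Set.Ioo (0:ℝ) 1} ∧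
      U.integrand = fun x => x 0 * x 1 / ((1 - x 0 * x 1) * (1 + x 0 * x 1 * x 2 * x 3)) := by
    refine m4k_exists_box (MvPolynomial.X 0 * MvPolynomial.X 1)
      ((1 - MvPolynomial.X 0 * MvPolynomial.X 1) *
        (1 + MvPolynomial.X 0 * MvPolynomial.X 1 * MvPolynomial.X 2 * MvPolynomial.X 3))
      (fun x => by simp only [map_mul, map_sub, map_add, map_one, MvPolynomial.aeval_X])
      (fun x hx => ?_) hGN fun x hx => ?_
    · obtain ⟨-, -, -, -, -, hu1, -, -, hP4⟩ := m4k_box_facts hx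
      simp only [map_mul, map_sub, map_add, map_one, MvPolynomial.aeval_X]
      exact (mul_pos (sub_pos.2 hu1) (by linarith)).ne'
    · obtain ⟨-, -, -, -, hu0, hu1, hv0, -, hP4⟩ := m4k_box_facts hx
      have hA : 0 < 1 - x 0 * x 1 := sub_pos.2 hu1
      show |x 0 * x 1 / ((1 - x 0 * x 1) * (1 + x 0 * x 1 * x 2 * x 3))| ≤
        2 * (1 / (1 - x 0 * x 1) * (1 / (1 + x 2 * x 3)))
      rw [abs_of_pos (div_pos hu0 (mul_pos hA (by linarith))), one_div_mul_one_div, mul_one_div,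
        div_le_div_iff₀ (mul_pos hA (by linarith)) (mul_pos hA (by linarith))]
      nlinarith [mul_nonneg hA.le hP4.le, mul_nonneg hA.le (show (0:ℝ) ≤ 2 - x 0 * x 1 by linarith)]
  obtain ⟨U2p, hU2pd, hU2pi⟩ : ∃ U : IntegralRep 4, U.domain = {x | ∀ i, x i ∈ Set.Ioo (0:ℝ) 1} ∧
      U.integrand = fun x => x 2 * x 3 / ((1 + x 2 * x 3) * (1 + x 0 * x 1 * x 2 * x 3)) := by
    refine m4k_exists_box (MvPolynomial.X 2 * MvPolynomial.X 3)
      ((1 + MvPolynomial.X 2 * MvPolynomial.X 3) *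
        (1 + MvPolynomial.X 0 * MvPolynomial.X 1 * MvPolynomial.X 2 * MvPolynomial.X 3))
      (fun x => by simp only [map_mul, map_add, map_one, MvPolynomial.aeval_X])
      (fun x hx => ?_) hG3 fun x hx => ?_
    · obtain ⟨-, -, -, -, -, -, hv0, -, hP4⟩ := m4k_box_facts hx
      simp only [map_mul, map_add, map_one, MvPolynomial.aeval_X]
      exact (mul_pos (by linarith) (by linarith)).ne'
    · obtain ⟨-, -, -, -, -, -, hv0, -, hP4⟩ := m4k_box_facts hx
      have hB : (0:ℝ) < 1 + x 2 * x 3 := by linarith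
      have hC : (0:ℝ) < 1 + x 0 * x 1 * x 2 * x 3 := by linarith
      show |x 2 * x 3 / ((1 + x 2 * x 3) * (1 + x 0 * x 1 * x 2 * x 3))| ≤
        1 / (1 + x 0 * x 1 * x 2 * x 3)
      rw [abs_of_pos (div_pos hv0 (mul_pos hB hC)), div_le_div_iff₀ (mul_pos hB hC) hC]
      nlinarith [hP4]
  have hsplit : of N - ((1:ℤ) • of T3 + (1:ℤ) • of U1 + (-1:ℤ) • of U2p) ∈ relations := by
    have h := aff_orbit_of_sub_sum_zsmul_mem_relations (Finset.univ : Finset (Fin 3))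
      ![T3, U1, U2p] ![1, 1, -1] N (fun i _ => by
        fin_cases i
        · exact hT3d.trans hNd.symm
        · exact hU1d.trans hNd.symm
        · exact hU2pd.trans hNd.symm) fun x hx => ?_
    · simpa [Fin.sum_univ_three] using h
    have hx' : ∀ i, x i ∈ Set.Ioo (0:ℝ) 1 := by rw [hNd] at hx; exact hx
    obtain ⟨-, -, -, -, -, hu1, hv0, -, hP4⟩ := m4k_box_facts hx'
    have hA : 1 - x 0 * x 1 ≠ 0 := (sub_pos.2 hu1).ne'
    have hB : 1 + x 2 * x 3 ≠ 0 := (show (0:ℝ) < 1 + x 2 * x 3 by linarith).ne'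
    have hC : 1 + x 0 * x 1 * x 2 * x 3 ≠ 0 := (show (0:ℝ) < 1 + x 0 * x 1 * x 2 * x 3 by linarith).ne'
    rw [hNi]
    simp only [Fin.sum_univ_three, Matrix.cons_val_zero, Matrix.cons_val_one, Matrix.cons_val_two,
      Matrix.head_cons, Matrix.tail_cons, hT3i, hU1i, hU2pi]
    push_cast
    field_simp
    ring
  /- (iii) the permuted box: `U2p` is the standard nested box `U2 = [□⁴, u/((1+u)(1+Π))]` with
    its coordinates permuted by `(0 1 2 3) ↦ (2 3 0 1)` (a congruence and one rule-(2) move) -/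
  obtain ⟨U2, hU2d, hU2i⟩ : ∃ U : IntegralRep 4, U.domain = {x | ∀ i, x i ∈ Set.Ioo (0:ℝ) 1} ∧
      U.integrand = fun x => x 0 * x 1 / ((1 + x 0 * x 1) * (1 + x 0 * x 1 * x 2 * x 3)) := by
    refine m4k_exists_box (MvPolynomial.X 0 * MvPolynomial.X 1)
      ((1 + MvPolynomial.X 0 * MvPolynomial.X 1) *
        (1 + MvPolynomial.X 0 * MvPolynomial.X 1 * MvPolynomial.X 2 * MvPolynomial.X 3))
      (fun x => by simp only [map_mul, map_add, map_one, MvPolynomial.aeval_X])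
      (fun x hx => ?_) hG3 fun x hx => ?_
    · obtain ⟨-, -, -, -, hu0, -, -, -, hP4⟩ := m4k_box_facts hx
      simp only [map_mul, map_add, map_one, MvPolynomial.aeval_X]
      exact (mul_pos (by linarith) (by linarith)).ne'
    · obtain ⟨-, -, -, -, hu0, -, -, -, hP4⟩ := m4k_box_facts hx
      have hB : (0:ℝ) < 1 + x 0 * x 1 := by linarith
      have hC : (0:ℝ) < 1 + x 0 * x 1 * x 2 * x 3 := by linarith
      show |x 0 * x 1 / ((1 + x 0 * x 1) * (1 + x 0 * x 1 * x 2 * x 3))| ≤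
        1 / (1 + x 0 * x 1 * x 2 * x 3)
      rw [abs_of_pos (div_pos hu0 (mul_pos hB hC)), div_le_div_iff₀ (mul_pos hB hC) hC]
      nlinarith [hP4]
  obtain ⟨σ, hσ0, hσ1, hσ2, hσ3⟩ : ∃ e : Fin 4 ≃ Fin 4, e 0 = 2 ∧ e 1 = 3 ∧ e 2 = 0 ∧ e 3 = 1 :=
    ⟨⟨![2, 3, 0, 1], ![2, 3, 0, 1], by decide, by decide⟩, rfl, rfl, rfl, rfl⟩
  have hperm1 : of U2p - of (U2.reindex σ) ∈ relations := by
    refine of_sub_of_mem_relations_of_eqOn ?_ fun w _ => ?_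
    · rw [IntegralRep.reindex_domain, hU2d, hU2pd]
      ext w
      simp only [mem_setOf_eq]
      exact ⟨fun h i => by simpa using h (σ.symm i), fun h i => h (σ i)⟩
    · rw [IntegralRep.reindex_integrand, hU2i, hU2pi]
      simp only [hσ0, hσ1, hσ2, hσ3]
      ring
  have hperm2 : of U2 - of (U2.reindex σ) ∈ relations := of_sub_of_reindex_mem_relations U2 σ
  /- (iv) the three cubical charts `□⁴ → Δ₄` (rule 2): `T3 ≡ [aaac]`, `U1 ≡ [abac]`, `U2 ≡ [acac]` -/
  have c3 : of T3 - of AAAC ∈ relations := by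
    refine m4_box_sub_simplex4.1 (fun t => 1 / t 0 * (1 / t 1) * (1 / t 2) * (1 / (1 + t 3)))
      T3 AAAC hT3d hAAACd (hAAACi ▸ fun _ _ => rfl) fun x hx => ?_
    have hx' : ∀ i, x i ∈ Set.Ioo (0:ℝ) 1 := by rw [hT3d] at hx; exact hx
    obtain ⟨h0, h1, h2, -, -, -, -, -, hP4⟩ := m4k_box_facts hx'
    have h0' : x 0 ≠ 0 := h0.ne'
    have h1' : x 1 ≠ 0 := h1.ne'
    have h2' : x 2 ≠ 0 := h2.ne'
    have hC : 1 + x 0 * x 1 * x 2 * x 3 ≠ 0 := (show (0:ℝ) < 1 + x 0 * x 1 * x 2 * x 3 by linarith).ne'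
    simp only [hT3i, Matrix.cons_val_zero, Matrix.cons_val_one, Matrix.cons_val_two,
      Matrix.cons_val_three, Matrix.head_cons, Matrix.tail_cons]
    field_simp
  have c1 : of U1 - of ABAC ∈ relations := by
    refine m4_box_sub_simplex4.1 (fun t => 1 / t 0 * (1 / (1 - t 1)) * (1 / t 2) * (1 / (1 + t 3)))
      U1 ABAC hU1d hABACd (hABACi ▸ fun _ _ => rfl) fun x hx => ?_
    have hx' : ∀ i, x i ∈ Set.Ioo (0:ℝ) 1 := by rw [hU1d] at hx; exact hx
    obtain ⟨h0, h1, h2, -, -, hu1, -, -, hP4⟩ := m4k_box_facts hx'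
    have h0' : x 0 ≠ 0 := h0.ne'
    have h1' : x 1 ≠ 0 := h1.ne'
    have h2' : x 2 ≠ 0 := h2.ne'
    have hA : 1 - x 0 * x 1 ≠ 0 := (sub_pos.2 hu1).ne'
    have hC : 1 + x 0 * x 1 * x 2 * x 3 ≠ 0 := (show (0:ℝ) < 1 + x 0 * x 1 * x 2 * x 3 by linarith).ne'
    simp only [hU1i, Matrix.cons_val_zero, Matrix.cons_val_one, Matrix.cons_val_two,
      Matrix.cons_val_three, Matrix.head_cons, Matrix.tail_cons]
    field_simp
  have c2 : of U2 - of ACAC ∈ relations := by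
    refine m4_box_sub_simplex4.1 (fun t => 1 / t 0 * (1 / (1 + t 1)) * (1 / t 2) * (1 / (1 + t 3)))
      U2 ACAC hU2d hACACd (hACACi ▸ fun _ _ => rfl) fun x hx => ?_
    have hx' : ∀ i, x i ∈ Set.Ioo (0:ℝ) 1 := by rw [hU2d] at hx; exact hx
    obtain ⟨h0, h1, h2, -, hu0, -, -, -, hP4⟩ := m4k_box_facts hx'
    have h0' : x 0 ≠ 0 := h0.ne'
    have h1' : x 1 ≠ 0 := h1.ne'
    have h2' : x 2 ≠ 0 := h2.ne'
    have hB : 1 + x 0 * x 1 ≠ 0 := (show (0:ℝ) < 1 + x 0 * x 1 by linarith).ne'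
    have hC : 1 + x 0 * x 1 * x 2 * x 3 ≠ 0 := (show (0:ℝ) < 1 + x 0 * x 1 * x 2 * x 3 by linarith).ne'
    simp only [hU2i, Matrix.cons_val_zero, Matrix.cons_val_one, Matrix.cons_val_two,
      Matrix.cons_val_three, Matrix.head_cons, Matrix.tail_cons]
    field_simp
  /- (v) bookkeeping -/
  have e : of (AB.prod AC) - of AAAC - of ABAC + of ACAC =
      (of N - ((1:ℤ) • of T3 + (1:ℤ) • of U1 + (-1:ℤ) • of U2p)) - (of N - of (AB.prod AC))
        + (of T3 - of AAAC) + (of U1 - of ABAC) - (of U2p - of (U2.reindex σ))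
        + (of U2 - of (U2.reindex σ)) - (of U2 - of ACAC) := by
    simp only [one_smul, neg_smul]; abel
  rw [e]
  exact relations.sub_mem (relations.add_mem (relations.sub_mem (relations.add_mem
    (relations.add_mem (relations.sub_mem hsplit hP) c3) c1) hperm1) hperm2) c2

end Summit.KontsevichZagierPeriods.HurwitzMicroSectors.NormalFormPrinciple.PiBox.M3
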